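import Summits.HodgeConjecture.HodgeConjecture.Theorems.EquidimRelDimOfQuotientMapsDeg
import Summits.HodgeConjecture.HodgeConjecture.Theorems.EquidimHeckeQuotientFamily
import Summits.HodgeConjecture.HodgeConjecture.Theorems.EquidimHeckeQuotientTriplesOfPiece
import Summits.HodgeConjecture.HodgeConjecture.Theorems.EquidimHExtOfPiece
import HarnessLib

/-!
# E-road, closed on the Theorems side: `(F) ⇒ (F′)` and `(F) ⇒ hDel`, sorry-free, WITHOUT the Cruxes workfile

Cell hodgecm-mathlib (D-0151), E-road «EQUIDIM by proof» (B-plan1 (g15) 2026-08-30T01:41:02Z (3a); director g10 s204).  The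
E-road workfile `Cruxes/HDel/Lines/EquidimOfF.lean` v1.5 closes its last `sorry` `stub_quotientTriples₈` over the COMPOSER ★
`EquidimHExtOfPiece.hExt_of_piece` (B-p04 (g18)).  This file is the same closure as three THEOREMS over ★ `Theorems/*` files only —
no Cruxes import, no file-local `def`, no re-declaration of the workfile's glue (all of which is ★ in (E1)–(E4)/(E-f)):

* `socketQuotientMaps_of_hExt` — **SOCKET (B) OF THE HECKE LINK, TEXT v8, AS A THEOREM** (its statement is the v8 text
  `B-plan/F-census/SOCKET-B-v8.text` 50c62588 token-for-token = the `hQuot₃` binder of ★ (E-f)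
  `EquidimRelDimOfQuotientMaps.relDim_of_quotientMaps₃`): the (O-y) theorem ★ p751581
  `EquidimHeckeQuotientFamily.socketQuotientMaps_of_quotientTriples` fed with the quotient triples over the thick open piece, ★ p753187
  `EquidimHeckeQuotientTriplesOfPiece.socketQuotientTriples_of_ext` ∘ the composer ★ `EquidimHExtOfPiece.hExt_of_piece` (= v1.5
  :825–:843 verbatim);
* `relDim_of_F (hF : (F)) : (F′)` := ★ (E-f) p753175 `EquidimRelDimOfQuotientMaps.relDim_of_quotientMaps₃ hF socketQuotientMaps_of_hExt`
  ((F′) = ★ p737414 `lan2013_siegelFineModuliScheme_relDim`: the Siegel fine moduli scheme is smooth of relative dimension `g(g+1)/2`);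
* `HDel_of_F_E (hF : (F)) : Summit.HodgeConjecture.HodgeConjecture.Theses.HCCMUnconditional.HDel` := ★ (E-f)
  `EquidimRelDimOfQuotientMaps.HDel_of_quotientMaps₃ hF socketQuotientMaps_of_hExt` — the crux decl BY NAME from the ONE printed
  citation (F) [Lan2013PELCompactifications, Thm. 1.4.1.11].

THEOREMS ONLY, PROOF lane `--as helper --supports stmt-HodgeConjecture-24835`; axioms ⊆ {propext, Classical.choice, Quot.sound}.
HC_CM is proved only modulo the 7 printed citations until rung 0 closes.

## References
* [Lan2013PELCompactifications] K.-W. Lan, *Arithmetic compactifications of PEL-type Shimura varieties* (2013), Thm. 1.4.1.11 (p. 91),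
  Cor. 7.2.3.9 (p. 518).
* [MumfordFogartyKirwan1994] D. Mumford, J. Fogarty, F. Kirwan, *Geometric Invariant Theory* (3rd ed. 1994), Ch. 7 §3 Thm. 7.9
  (p. 139), Appendix to Ch. 7 §A (p. 235).
* [Milne2005ShimuraVarieties] J. S. Milne, *Introduction to Shimura varieties* (2005), §6 Thm. 6.11 (pp. 74–75).
* [MumfordAV1970] D. Mumford, *Abelian Varieties* (1970), §7 Thm. (p. 66) and Thm. 4 (p. 72), §23 Thm. 2 (p. 231).
* [GortzWedhorn2023] U. Görtz, T. Wedhorn, *Algebraic Geometry II* (2023), Thm. 27.301 (p. 733).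
-/

set_option autoImplicit false
set_option linter.dupNamespace false  -- `Summit.HodgeConjecture.HodgeConjecture.…` is the cell's layout (D-0017)

noncomputable section

open CategoryTheory CategoryTheory.Limits AlgebraicGeometry Topology IsLocalRing
open Literature.AlgebraicGeometry
open Literature.AlgebraicGeometry.Motives (SchemeOver ComplexPoints AlgPoints specOver)
open Literature.AlgebraicGeometry.AbelianSchemes (PolarizedAbelianSchemeWithLevel)
open Literature.AlgebraicGeometry.ModuliOfAbelianVarieties
open Literature.AlgebraicGeometry.ModuliOfAbelianVarieties.EquidimOfF
open Literature.NumberTheory.Automorphic (siegelUpperHalfSpace)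
open Literature.NumberTheory.Adeles

namespace Summit.HodgeConjecture.HodgeConjecture.Theorems

namespace EquidimRelDimOfF

open SiegelModuli

/-- **SOCKET (B) OF THE HECKE LINK — «THE ISOGENY-QUOTIENT MAP», TEXT v8, AS A THEOREM** (the `hQuot₃` hypothesis of ★ (E-f)
`EquidimRelDimOfQuotientMaps.relDim_of_quotientMaps₃`, discharged): whenever the OPEN piece `ι′ : S″ ⟶ 𝓜′_ℂ` has `ι′ s′`
Hecke-linked to `x` at `r′` with similitude degree `N′/N` ODD and COPRIME TO `∏ δᵢ`, and `S″` is thick at `s′` w.r.t. `r′`, there is a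
CONTINUOUS `Φ : S″(ℂ) → 𝓜_ℂ(ℂ)` with `Φ s′ = x`, an open `θ` and a principal `r` carrying admissibility from `(ι′ s, Z, r′)` to
`(Φ s, θ Z, r)` — the (O-y) theorem `EquidimHeckeQuotientFamily.socketQuotientMaps_of_quotientTriples` fed with the quotient triples
over the piece (`EquidimHeckeQuotientTriplesOfPiece.socketQuotientTriples_of_ext` ∘ the composer `EquidimHExtOfPiece.hExt_of_piece`).
[cite: Milne2005ShimuraVarieties, §6 Thm. 6.11 pp. 74–75] [cite: MumfordFogartyKirwan1994, Ch. 7 §3 Theorem 7.9 (p. 139)]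
[cite: MumfordAV1970, §7 Thm. p. 66 and Thm. 4 (p. 72); §23 Thm. 2 (p. 231)] -/
theorem socketQuotientMaps_of_hExt :
    ∀ (_hF : lan2013_siegelFineModuliScheme) (g N N' : ℕ) (δ δ' : Fin g → ℕ) (_hg : 0 < g)
      (hδ : IsPolarizationType δ) (_hN : 3 ≤ N) (hδ' : IsPolarizationType δ')
      (𝓜 : SiegelFineModuliScheme g N δ) (𝓜' : SiegelFineModuliScheme g N' δ')
      (S'' : SchemeOver ℂ) (ι' : S'' ⟶ (Motives.baseChange ℚ ℂ).obj 𝓜'.M) [IsOpenImmersion ι'.left]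
      (d'' : ℕ) [SmoothOfRelativeDimension d'' S''.hom] (r' : gspFinAdelic δ') (_ : r' ∈ principalLevelSubgroup δ' 1)
      (s' : ComplexPoints S'') (_ : IsThickAtWith hδ' 𝓜' ι' d'' s' r')
      (x : ComplexPoints ((Motives.baseChange ℚ ℂ).obj 𝓜.M)),
      HeckeLinkedDeg 𝓜 𝓜' r' (AlgPoints.map (L := ℂ) ι' s') x (N' / N) → Odd (N' / N) → Nat.Coprime (N' / N) (∏ i, δ i) →
      haveI : IsLocallyNoetherian (specOver ℚ ℂ).left := inferInstanceAs (IsLocallyNoetherian (Spec (CommRingCat.of ℂ)))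
      ∃ (Φ : ComplexPoints S'' → ComplexPoints ((Motives.baseChange ℚ ℂ).obj 𝓜.M)) (_ : Continuous Φ) (_ : Φ s' = x)
        (θ : siegelUpperHalfSpace g → siegelUpperHalfSpace g) (_ : IsOpenMap θ)
        (r : gspFinAdelic δ) (_ : r ∈ principalLevelSubgroup δ 1),
        ∀ (s : ComplexPoints S'') (Z : siegelUpperHalfSpace g)
          (P' : PolarizedAbelianSchemeWithLevel g N' δ' (specOver ℚ ℂ).left),
          IsAdmissibleAt hδ' r' Z.1 Z.2 P' →
          AlgPoints.baseChangeEquiv (algebraMap ℚ ℂ) 𝓜'.M (𝓜'.classifyingMap (specOver ℚ ℂ) P') =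
            AlgPoints.map (L := ℂ) ι' s →
          ∃ P : PolarizedAbelianSchemeWithLevel g N δ (specOver ℚ ℂ).left,
            IsAdmissibleAt hδ r (θ Z).1 (θ Z).2 P ∧
            AlgPoints.baseChangeEquiv (algebraMap ℚ ℂ) 𝓜.M (𝓜.classifyingMap (specOver ℚ ℂ) P) = Φ s := by
  intro hF g N N' δ δ' hg hδ hN hδ' 𝓜 𝓜' S'' ι' _ d'' _ r' hr' s' hth x hlink hodd hcop
  refine EquidimHeckeQuotientFamily.socketQuotientMaps_of_quotientTriples hF g N N' δ δ' hg hδ hN hδ' 𝓜 𝓜' S'' ι' d'' r'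
    hr' s' hth x hlink hodd hcop ?_
  intro _ ι'ℚ hι γq r hr hQA hsim γm hγ
  exact EquidimHeckeQuotientTriplesOfPiece.socketQuotientTriples_of_ext hF g N N' δ δ' hg hδ hN hδ' 𝓜 𝓜' S'' ι' d'' r' hr'
    s' hth x hlink hodd hcop ι'ℚ hι γq r hr hQA hsim γm hγ
    (EquidimHExtOfPiece.hExt_of_piece hF g N N' δ δ' hg hδ hN hδ' 𝓜 𝓜' S'' ι' d'' r' hr' s' hth x hlink hodd hcop ι'ℚ hι γq
      r hr hQA hsim γm hγ)

/-- **THE E-ROAD HEAD, SORRY-FREE: `(F) ⇒ (F′)`** — from the ONE printed citation (F) «`𝓜_{g,δ,N}` is a smooth quasi-projective fine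
moduli scheme over `ℚ`» the Siegel fine moduli scheme is smooth OF RELATIVE DIMENSION `g(g+1)/2` ((F′) = ★ p737414
`lan2013_siegelFineModuliScheme_relDim`), by the E-road (★ (E-f) `relDim_of_quotientMaps₃` over socket (B) v8 = `socketQuotientMaps_of_hExt`).
[cite: Lan2013PELCompactifications, Thm. 1.4.1.11 p. 91] [cite: GortzWedhorn2023, Thm. 27.301 p. 733] -/
theorem relDim_of_F (hF : lan2013_siegelFineModuliScheme) : lan2013_siegelFineModuliScheme_relDim :=
  EquidimRelDimOfQuotientMaps.relDim_of_quotientMaps₃ hF socketQuotientMaps_of_hExt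

/-- **THE hDel JUNCTION OF THE E-ROAD, SORRY-FREE: `(F) ⇒ hDel`** — the crux decl
`Summit.HodgeConjecture.HodgeConjecture.Theses.HCCMUnconditional.HDel` BY NAME from the printed citation (F) alone (★ (E-f)
`HDel_of_quotientMaps₃` = ★ `HDel_of_F_U` ∘ ★ `UOfF.U_of_relDim_F` ∘ `relDim_of_quotientMaps₃`, over `socketQuotientMaps_of_hExt`).
[cite: Lan2013PELCompactifications, Thm. 1.4.1.11 p. 91, Cor. 7.2.3.9 (p. 518)] -/
theorem HDel_of_F_E (hF : lan2013_siegelFineModuliScheme) :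
    Summit.HodgeConjecture.HodgeConjecture.Theses.HCCMUnconditional.HDel :=
  EquidimRelDimOfQuotientMaps.HDel_of_quotientMaps₃ hF socketQuotientMaps_of_hExt

end EquidimRelDimOfF

end Summit.HodgeConjecture.HodgeConjecture.Theorems

end
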